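import Summits.QuantumFields.YangMills.Theses.SamplerStability
import Literature.MathematicalPhysics.QuantumFieldTheory.Balaban1983to89.T3CovarianceRP

/-!
# Route `SamplerStability` (planner seat ym-idea-5 g9), support item `WaistToLeaf` (stmt-QuantumFields-28103): the WAIST — total-variation
# summability of consecutive renormalised unit laws in dual bounded-measurable form — gives `ContinuumYM3Torus F expMeanLogSU γ`

Width seat ym-line-sfw-p2-w2 g20 (cell `ym-idea-1`, free hands).  Critic #109 price 2: «provable NOW, LAND FIRST — it certifies the reduction for ANY
currency delivering TV/Hellinger summability».  Rung R3 of LADDER-YM is a RECORD rung: no summit, no mass gap is proved; the WAIST itself (and the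
route's cruxes `UnitSamplerGap`, `SpecificationRate`) stay open.

THE ARGUMENT.  By `T3CovarianceRP.continuumYM3Torus_iff_hasContinuumLimit_SU` (reflection positivity, covariance and uniqueness are outright on
`SU(2)`), it suffices that every unit loop-string expectation `K ↦ ⟨∏_{C∈os} W̄_C⟩_K` converges.  By `T3ThresholdRemoval.expectAt_eq_integral_unitLaw`
this is `K ↦ ∫ f_os dν_K` with `f_os(u) = ∏_C loopAt u (C.atLevel 0)` measurable and `|f_os| ≤ 1`; the WAIST gives `|∫ f_os dν_{K+1} − ∫ f_os dν_K| ≤ d_K`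
for `K ≥ K₀` with `Σ d_K < ∞`, so the shifted sequence is Cauchy (`cauchySeq_of_dist_le_of_summable`) and converges in `ℝ`.

References: A. Jaffe, E. Witten, *Quantum Yang–Mills theory* (Clay, 2006) §6.5 (existence of the `ε → 0` limits is the point at issue);
T. Bałaban, CMP **109** (1987) 249–301 [Balaban1987RG1] ((0.2)/(0.4) p.252: unit-scale averaged expectations).
-/

set_option autoImplicit false

noncomputable section

open MeasureTheory Filter Topology

namespace Summit.QuantumFields.YangMills.Theorems.SamplerStabilityWaist

open Literature.MathematicalPhysics.QuantumFieldTheory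
open Literature.MathematicalPhysics.QuantumFieldTheory.Balaban1983to89
open Literature.MathematicalPhysics.QuantumFieldTheory.Balaban1983to89.T3ContinuumYM3Torus
open Literature.MathematicalPhysics.QuantumFieldTheory.Balaban1983to89.T3ThresholdRemoval (expectAt_eq_integral_unitLaw)
open Literature.MathematicalPhysics.QuantumFieldTheory.Balaban1983to89.T4Continuum

/-- Products of a list of measurable real functions are measurable (local helper; twin of the private helper of `T3ThresholdRemoval`). [folklore] -/
private theorem measurable_list_prod {X : Type*} [MeasurableSpace X] {ι : Type*} (f : ι → X → ℝ)
    (hf : ∀ i, Measurable (f i)) : ∀ l : List ι, Measurable fun x => (l.map fun i => f i x).prod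
  | [] => by simp
  | i :: l => by
    show Measurable fun x => f i x * (l.map fun i => f i x).prod
    exact (hf i).mul (measurable_list_prod f hf l)

/-- Products of a list of functions bounded by `1` are bounded by `1` (local helper). [folklore] -/
private theorem abs_list_prod_le_one {X : Type*} {ι : Type*} (f : ι → X → ℝ) (hf : ∀ i x, |f i x| ≤ 1) (x : X) :
    ∀ l : List ι, |(l.map fun i => f i x).prod| ≤ 1
  | [] => by simp
  | i :: l => by
    rw [List.map_cons, List.prod_cons, abs_mul]
    exact mul_le_one₀ (hf i x) (abs_nonneg _) (abs_list_prod_le_one f hf x l)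

/-- **A real sequence with eventually summable increments converges**: `|a(K+1) − a(K)| ≤ d_K` for `K ≥ K₀` and `Σ d_K < ∞` give a limit. [folklore] -/
theorem exists_tendsto_of_eventually_summable_increments {a d : ℕ → ℝ} {K₀ : ℕ} (hd : Summable d)
    (h : ∀ K : ℕ, K₀ ≤ K → |a (K + 1) - a K| ≤ d K) : ∃ l : ℝ, Tendsto a atTop (𝓝 l) := by
  -- the shifted sequence `b n = a (n + K₀)` has summable consecutive distances
  have hb : CauchySeq fun n => a (n + K₀) := by
    refine cauchySeq_of_dist_le_of_summable (fun n => d (n + K₀)) (fun n => ?_) ((summable_nat_add_iff K₀).mpr hd)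
    rw [Real.dist_eq, abs_sub_comm, show n.succ + K₀ = n + K₀ + 1 by omega]
    exact h (n + K₀) (Nat.le_add_left K₀ n)
  obtain ⟨l, hl⟩ := cauchySeq_tendsto_of_complete hb
  exact ⟨l, (tendsto_add_atTop_iff_nat K₀).mp hl⟩

/-- ★★ **`WaistToLeaf` HOLDS** (support item stmt-QuantumFields-28103 of route `SamplerStability`): the WAIST (TV-summable consecutive unit laws
in dual bounded-measurable form, from some `K₀` on) implies `ContinuumYM3Torus F expMeanLogSU γ` for every family `F` and `γ > 0` — every unit
loop-string expectation is `∫ f dν_K` with `f` measurable, `|f| ≤ 1` (`expectAt_eq_integral_unitLaw`), hence has summable increments, hence converges;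
RP / covariance / uniqueness are outright on `SU(2)` (`continuumYM3Torus_iff_hasContinuumLimit_SU`). [cite: JaffeWittenClay2006, §6.5 p.11] -/
theorem waistToLeaf_proof : Summit.QuantumFields.YangMills.Theses.SamplerStability.WaistToLeaf := by
  unfold Summit.QuantumFields.YangMills.Theses.SamplerStability.WaistToLeaf
  intro F γ hγ hW
  obtain ⟨K₀, d, hd, hstep⟩ := hW
  rw [continuumYM3Torus_iff_hasContinuumLimit_SU F (ExpMeanLog.expMeanLogSU : LoopAverage (Matrix.specialUnitaryGroup (Fin 2) ℂ))
    T4ApexTwoLevel.measurableE_expMeanLogSU hγ.le]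
  intro os
  -- the unit-field observable of the string `os`
  set f : GaugeField (F.P 0) 0 (Matrix.specialUnitaryGroup (Fin 2) ℂ) → ℝ :=
    fun u => (os.map fun C => loopAt u (C.1.atLevel 0)).prod with hf
  have hfm : Measurable f :=
    measurable_list_prod (fun (C : ULoop3 F) (u : GaugeField (F.P 0) 0 (Matrix.specialUnitaryGroup (Fin 2) ℂ)) =>
      loopAt u (C.1.atLevel 0)) (fun C => measurable_loopAt _) os
  have hf1 : ∀ u, |f u| ≤ 1 := fun u =>
    abs_list_prod_le_one (fun (C : ULoop3 F) (u : GaugeField (F.P 0) 0 (Matrix.specialUnitaryGroup (Fin 2) ℂ)) =>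
      loopAt u (C.1.atLevel 0)) (fun C u => abs_loopAt_le_one _ _) u os
  -- the expectations as integrals over the unit laws
  have hkey : (fun K => (F.scheme (ExpMeanLog.expMeanLogSU : LoopAverage (Matrix.specialUnitaryGroup (Fin 2) ℂ)) γ).expectAt K os) =
      fun K => ∫ u, f u ∂F.unitLaw (ExpMeanLog.expMeanLogSU : LoopAverage (Matrix.specialUnitaryGroup (Fin 2) ℂ))
        T4ApexTwoLevel.measurableE_expMeanLogSU γ K :=
    funext fun K => expectAt_eq_integral_unitLaw T4ApexTwoLevel.measurableE_expMeanLogSU hγ.le K os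
  rw [hkey]
  exact exists_tendsto_of_eventually_summable_increments hd fun K hK => hstep K hK f hfm hf1

end Summit.QuantumFields.YangMills.Theorems.SamplerStabilityWaist

end
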